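import Literature.MathematicalPhysics.QuantumLattice.WightmanEuclidReach
import Literature.MathematicalPhysics.QuantumLattice.BargmannHallWightmanHolds
import Literature.MathematicalPhysics.QuantumLattice.SchwingerWightmanBoundaryValueProofs
import Literature.MathematicalPhysics.QuantumLattice.SchwartzTensorDensityProofs
import Literature.Analysis.Distribution.FourierLaplaceBoundaryValue
import Literature.Analysis.FunctionSpaces.WightmanSpectralProofs
import HarnessLib

/-!
# Symmetry of the Schwinger functions from Euclidean re-sorting consistency (`d ≥ 2` and `d = 0`)

Topic `Literature/MathematicalPhysics/QuantumLattice` (trunk T-AQFT). Assembly for the named fact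
`IsWickRotationOf.schwinger_symmetric` (`SchwingerWightman`; Osterwalder–Schrader I (1973) §4
(4.12) with (E3), §5 p. 97; Glimm–Jaffe (1987) Cor. 19.5.6; Streater–Wightman (1964) Thm. 3-6):
symmetry and real analyticity of the Schwinger functions of a Wightman QFT of one scalar field at
non-coincident Euclidean points.

The existing assembly `IsWickRotationOf.schwinger_symmetric_of` (`SchwingerWightmanSymmetry`)
consumes the *symmetric continuation to the whole permuted extended tube*
(`IsWightmanQFT.exists_symmetric_continuation`), i.e. the single-valuedness (K) on `𝒯'ₙ ∩ σ𝒯'ₙ`,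
for which the printed sources are four-dimensional (Jost, Tomozawa) and which fails to have real
points in `d = 1`. Here the requirement is weakened to what the Schwinger functions actually
need — consistency **at the Euclidean points** under re-sorting:

* `IsWightmanQFT.euclid_continuation_perm_eq` (a `Prop`): for the `L₊(ℂ)`-invariant continuation
  `𝔚` of the `n`-point function of one scalar field, every injective Euclidean configuration `x`
  has `e(x) ∘ eSort x ∈ 𝒯'ₙ`, and `𝔚(e(x') ∘ eSort x') = 𝔚(e(x') ∘ eSort x)` for all `x'` near `x`
  (`eSort` = lexicographic sorting, `WightmanEuclidSort`);
* `IsWickRotationOf.schwinger_symmetric_of_euclid` (**assembly**, every `d`): uniqueness of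
  boundary values + the invariant continuation (S–W Thm. 3-5 with BHW) + density of tensor
  products + Euclidean re-sorting consistency imply `schwinger_symmetric`, with the Schwinger
  function `𝔖(x) = 𝔚(e(x) ∘ eSort x)` (symmetric by relabelling invariance of sorting; equal to
  `𝔚(e(x))` on time-ordered configurations; real analytic by the local constancy of the sorted
  branch);
* `IsWightmanQFT.euclid_continuation_perm_eq_holds` (`d = m + 2 ≥ 2`, from `perm_eSort_eq_nhds`,
  `WightmanEuclidReach`) and `IsWightmanQFT.euclid_continuation_perm_eq_holds_zero` (`d = 0`: the
  sorting permutation is locally constant);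
* **`IsWickRotationOf.schwinger_symmetric_holds_of_two_le`** (`d = m + 2 ≥ 2`) and
  **`IsWickRotationOf.schwinger_symmetric_holds_zero`** (`d = 0`): with the discharged spectral
  condition (`IsWightmanQFT.hasSpectralCondition_family_holds`, S–W Thm. 3-2 (b)),
  Bargmann–Hall–Wightman theorem (`BargmannHallWightmanHolds`), Fourier–Laplace representation
  (`fourierLaplace_coneSupport_holds`), uniqueness of boundary values
  (`eq_zero_of_distributionalBoundaryValue_zero_holds`) and tensor density
  (`denseSpan_tensorProducts_holds`), **the named fact `schwinger_symmetric` holds outright in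
  space dimension `d ≥ 2` and `d = 0`**. The case `d = 1` is not covered (no common real points of
  `𝒯'ₙ` and `σ𝒯'ₙ`; see `WightmanEuclidReach`), so the fact in its recorded all-`d` generality is
  not closed by this file.

## References

* K. Osterwalder, R. Schrader, Comm. Math. Phys. 31 (1973), §4 (4.12), §5 p. 97. [OsterwalderSchraderCMP1973]
* J. Glimm, A. Jaffe, *Quantum Physics* (1987), Cor. 19.5.6. [GlimmJaffeQP1987]
* R. F. Streater, A. S. Wightman, *PCT, Spin and Statistics, and All That* (1964), Thms. 3-5, 3-6. [StreaterWightman1964]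
-/

noncomputable section

open Filter Set Complex
open _root_.Topology
open scoped SchwartzMap

namespace Literature.MathematicalPhysics.QuantumLattice

variable {d : ℕ} {κ : Type*} {n : ℕ}

/-! ### Euclidean re-sorting consistency -/

/-- **Euclidean re-sorting consistency of the continued Wightman function** (the Euclidean-point
instance of "`W` and `W_π` continue one another as one holomorphic function", Streater–Wightman
Thm. 3-6, resp. of "analytic, single valued, symmetric … on `S'ₙ ⊇ Sₙ`", OS I §5 p. 97): for a
Wightman QFT and `n` copies of one hermitian scalar field, if `𝔚` is analytic on the extended
relative tube, `L₊(ℂ)`-invariant, with the `n`-point distribution as boundary value, then for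
every injective Euclidean configuration `x`, the sorted Euclidean point `e(x) ∘ eSort x` lies in
the extended relative tube and `𝔚(e(x') ∘ eSort x') = 𝔚(e(x') ∘ eSort x)` for all `x'` near `x`.
Proved below for `d ≥ 2` and `d = 0`. [cite: OsterwalderSchraderCMP1973, §5 p. 97] -/
def IsWightmanQFT.euclid_continuation_perm_eq : Prop :=
  ∀ {W : WightmanData d κ}, IsWightmanQFT W → ∀ (n : ℕ) (k : Fin n → κ), (∀ i j, k i = k j) →
    ∀ (𝔚 : (Fin n → Fin (d + 1) → ℂ) → ℂ), AnalyticOnNhd ℂ 𝔚 (relExtendedTube d n) →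
      (∃ T : 𝓢((Fin n → SpaceTime d), ℂ) →L[ℂ] ℂ,
        IsWightmanDistributionOf W n k T ∧ HasDistributionalBoundaryValue 𝔚 T) →
      (∀ Λ ∈ properComplexLorentzGroup d, ∀ z ∈ relExtendedTube d n,
        𝔚 (fun i => Λ (z i)) = 𝔚 z) →
      ∀ x : Fin n → EuclideanSpace ℝ (Fin (d + 1)), Function.Injective x →
        (fun k => euclideanPoint x (eSort x k)) ∈ relExtendedTube d n ∧
        ∀ᶠ x' in 𝓝 x, 𝔚 (fun k => euclideanPoint x' (eSort x' k)) =
          𝔚 (fun k => euclideanPoint x' (eSort x k))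

/-- **Euclidean re-sorting consistency holds in space dimension `d ≥ 2`**
(`perm_eSort_eq_nhds` with the locality of the Wightman distribution, S–W Thm. 3-2 (d), and the
certificate of the sorted configuration). [cite: OsterwalderSchraderCMP1973, §5 p. 97] -/
theorem IsWightmanQFT.euclid_continuation_perm_eq_holds {m : ℕ} :
    IsWightmanQFT.euclid_continuation_perm_eq (d := m + 2) (κ := κ) := by
  intro W hW n k hk 𝔚 h𝔚 hT hinv x hx
  obtain ⟨T, hTW, hbv⟩ := hT
  exact ⟨euclideanPoint_eSort_mem_relExtendedTube hx,
    perm_eSort_eq_nhds h𝔚 hbv (hW.isLocalDistribution hTW hk) hinv hx⟩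

/-- **Euclidean re-sorting consistency holds trivially in space dimension `d = 0`**: injective
configurations have distinct times, the sorted configuration has strictly increasing times (a point
of `𝒯ʳₙ`), and the sorting permutation is constant near `x`. [folklore] -/
theorem IsWightmanQFT.euclid_continuation_perm_eq_holds_zero :
    IsWightmanQFT.euclid_continuation_perm_eq (d := 0) (κ := κ) := by
  intro W _ n k _ 𝔚 _ _ _ x hx
  -- in `d = 0` the key is the time and injective configurations have strictly sorted times
  have hkey : ∀ (y : Fin n → EuclideanSpace ℝ (Fin (0 + 1))) (a b : Fin n),
      lexKey y a < lexKey y b ↔ y a 0 < y b 0 := by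
    intro y a b
    rw [lexKey_lt_iff]
    constructor
    · rintro ⟨μ, -, hμ⟩
      have : μ = 0 := Fin.fin_one_eq_zero μ
      subst this
      exact hμ
    · intro h
      exact ⟨0, fun ν hν => absurd hν (Fin.not_lt_zero ν), h⟩
  have hmono : StrictMono fun j => x (eSort x j) 0 := fun a b hab =>
    (hkey x _ _).1 (strictMono_lexKey_eSort hx hab)
  refine ⟨relForwardTube_subset_relExtendedTube (euclideanPoint_mem_relForwardTube
    (x := x ∘ eSort x) hmono), ?_⟩
  -- the sorting permutation is locally constant
  have hev : ∀ᶠ x' in 𝓝 x, StrictMono fun j => x' (eSort x j) 0 := by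
    have hsum : ∀ (y : Fin n → EuclideanSpace ℝ (Fin (0 + 1))) (a : Fin n),
        inner ℝ (uPow 0 1) (y a) = y a 0 := fun y a => by
      rw [inner_uPow, Fin.sum_univ_succ, Fin.sum_univ_zero]
      simp
    have h := eventually_strictMono_inner_nhds (u := uPow 0 1) (σ := eSort x) (x := x) (by
      intro a b hab
      simp only [hsum]
      exact hmono hab)
    filter_upwards [h] with x' hx'
    intro a b hab
    have := hx' hab
    simpa only [hsum] using this
  filter_upwards [hev] with x' hx'
  have hsm : StrictMono (lexKey x' ∘ eSort x) := fun a b hab => (hkey x' _ _).2 (hx' hab)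
  have heq : eSort x = eSort x' :=
    Tuple.eq_sort_iff.2 ⟨hsm.monotone, fun i j hij h => absurd h (hsm hij).ne⟩
  rw [← heq]

/-! ### Assembly -/

/-- The Euclidean point depends on each point separately: equal points give equal Euclidean
points. [folklore] -/
theorem euclideanPoint_congr_apply {x y : Fin n → EuclideanSpace ℝ (Fin (d + 1))} {j l : Fin n}
    (h : x j = y l) : euclideanPoint x j = euclideanPoint y l := by
  funext μ
  by_cases hμ : μ = 0
  · subst hμ; simp [h]
  · simp [euclideanPoint, hμ, h]

/-- `x' ↦ e(x') ∘ π` is real analytic (it is continuous linear). [folklore] -/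
theorem analyticAt_euclideanPoint_perm (π : Equiv.Perm (Fin n))
    (x : Fin n → EuclideanSpace ℝ (Fin (d + 1))) :
    AnalyticAt ℝ (fun x' : Fin n → EuclideanSpace ℝ (Fin (d + 1)) =>
      fun k => euclideanPoint x' (π k)) x := by
  have h1 : (fun x' : Fin n → EuclideanSpace ℝ (Fin (d + 1)) => fun k => euclideanPoint x' (π k)) =
      (fun z : Fin n → Fin (d + 1) → ℂ => fun k => z (π k)) ∘ euclideanPoint := by
    funext x'; rfl
  rw [h1]
  refine AnalyticAt.comp ?_ (analyticAt_euclideanPoint x)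
  exact (ContinuousLinearMap.pi fun k =>
    (ContinuousLinearMap.proj (π k) : (Fin n → Fin (d + 1) → ℂ) →L[ℝ] (Fin (d + 1) → ℂ))).analyticAt _

/-- **Assembly.** The symmetry and real analyticity of the Schwinger functions at non-coincident
points (`IsWickRotationOf.schwinger_symmetric`) follow from: uniqueness of distributional boundary
values (`eq_zero_of_distributionalBoundaryValue_zero`, S–W Thm. 2-17), the `L₊(ℂ)`-invariant
continuation of the Wightman functions to the extended tube
(`IsWightmanQFT.exists_invariant_continuation`, S–W Thm. 3-5 with BHW), the totality of tensor
products in `𝒮` (`denseSpan_tensorProducts`), and the Euclidean re-sorting consistency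
(`IsWightmanQFT.euclid_continuation_perm_eq`). The Schwinger function is `𝔖(x) = 𝔚ₑ(e(x) ∘ eSort x)`:
symmetric because sorting is relabelling invariant, equal to `𝔚(e(x))` on time-ordered
configurations (`eSort x = 1`, and `𝔚₀ = 𝔚ₑ` on the forward tube by uniqueness of the boundary
value), real analytic at injective `x` because near `x` it coincides with the analytic
`x' ↦ 𝔚ₑ(e(x') ∘ eSort x)`. [cite: OsterwalderSchraderCMP1973, §5 p. 97] -/
theorem IsWickRotationOf.schwinger_symmetric_of_euclid
    (hE : eq_zero_of_distributionalBoundaryValue_zero (d := d))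
    (hA : IsWightmanQFT.exists_invariant_continuation (d := d) (κ := κ))
    (hD : QuantumLattice.denseSpan_tensorProducts (E := SpaceTime d))
    (hKE : IsWightmanQFT.euclid_continuation_perm_eq (d := d) (κ := κ)) :
    IsWickRotationOf.schwinger_symmetric (d := d) (κ := κ) := by
  intro S W k hW h hk n
  obtain ⟨𝔚₀, h𝔚₀, ⟨T₀, hT₀, hbv₀⟩, hS⟩ := h n
  obtain ⟨𝔚ₑ, h𝔚ₑ, ⟨Tₑ, hTₑ, hbvₑ⟩, hinv, -⟩ := hA hW n (k n)
  have h𝔚ₑT : DifferentiableOn ℂ 𝔚ₑ (forwardTube d n) :=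
    h𝔚ₑ.differentiableOn.mono (QuantumFieldTheory.forwardTube_subset_relForwardTube.trans
      relForwardTube_subset_relExtendedTube)
  -- the Wightman distribution is unique
  have hT : T₀ = Tₑ := by
    refine ContinuousLinearMap.ext_on (hD n) ?_
    rintro F ⟨f, hF⟩
    rw [hT₀ _ F hF, hTₑ _ F hF]
  -- hence the two holomorphic functions agree on the forward tube
  have heq : ∀ z ∈ forwardTube d n, 𝔚₀ z = 𝔚ₑ z := by
    have hdiff : DifferentiableOn ℂ (fun z => 𝔚₀ z - 𝔚ₑ z) (forwardTube d n) := h𝔚₀.sub h𝔚ₑT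
    have hzero := hE (fun z => 𝔚₀ z - 𝔚ₑ z) hdiff (by
      intro η hη F hF
      have h1 := hbv₀ η hη F
      have h2 := hbvₑ η hη F
      rw [hT] at h1
      have h12 := h1.sub h2
      rw [sub_self] at h12
      refine h12.congr' ?_
      filter_upwards [self_mem_nhdsWithin] with t ht
      rw [← MeasureTheory.integral_sub (integrable_ray_mul h𝔚₀ hη ht hF)
        (integrable_ray_mul h𝔚ₑT hη ht hF)]
      simp only [sub_mul])
    intro z hz
    exact sub_eq_zero.1 (hzero z hz)
  -- the Euclidean re-sorting consistency for `𝔚ₑ`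
  have hKE' := hKE hW n (k n) (hk n) 𝔚ₑ h𝔚ₑ ⟨Tₑ, hTₑ, hbvₑ⟩ hinv
  refine ⟨𝔚₀, fun x => 𝔚ₑ (fun j => euclideanPoint x (eSort x j)), h𝔚₀, ⟨T₀, hT₀, hbv₀⟩, hS,
    ?_, ?_, ?_⟩
  · -- real analyticity at injective configurations
    intro x hx
    obtain ⟨hmem, hev⟩ := hKE' x hx
    have hF : AnalyticAt ℝ (fun x' : Fin n → EuclideanSpace ℝ (Fin (d + 1)) =>
        𝔚ₑ (fun j => euclideanPoint x' (eSort x j))) x :=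
      (h𝔚ₑ _ hmem).restrictScalars.comp (analyticAt_euclideanPoint_perm (eSort x) x)
    exact hF.congr (hev.mono fun x' hx' => hx'.symm)
  · -- agreement with `𝔚₀` on time-ordered configurations
    intro x h0 hmono
    have h1 : eSort x = 1 := eSort_eq_one_of_strictMono hmono
    simp only [h1, Equiv.Perm.coe_one, id_eq]
    exact (heq _ (euclideanPoint_mem_forwardTube h0 hmono)).symm
  · -- symmetry: sorting is relabelling invariant
    intro σ x _
    show 𝔚ₑ (fun j => euclideanPoint (x ∘ σ) (eSort (x ∘ σ) j)) =
      𝔚ₑ (fun j => euclideanPoint x (eSort x j))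
    congr 1
    funext j
    exact euclideanPoint_congr_apply (perm_eSort_comp_perm_apply x σ j)

/-! ### Consequences: the named fact holds for `d ≥ 2` and `d = 0` -/

/-- **Symmetry and real analyticity of the Schwinger functions in space dimension `d ≥ 2`: the
named fact `IsWickRotationOf.schwinger_symmetric` holds for `d = m + 2`** (OS I §4 (4.12)+(E3),
§5 p. 97; Glimm–Jaffe Cor. 19.5.6; S–W Thm. 3-6), from the discharged spectral condition
(`IsWightmanQFT.hasSpectralCondition_family_holds`), Bargmann–Hall–Wightman theorem and
Fourier–Laplace representation (`IsWightmanQFT.exists_invariant_continuation_of_spectral_of_laplace`,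
`fourierLaplace_coneSupport_holds`), uniqueness of boundary values
(`eq_zero_of_distributionalBoundaryValue_zero_holds`), tensor density
(`denseSpan_tensorProducts_holds`) and Euclidean re-sorting consistency
(`IsWightmanQFT.euclid_continuation_perm_eq_holds`). [cite: OsterwalderSchraderCMP1973, §5 p. 97] -/
theorem IsWickRotationOf.schwinger_symmetric_holds_of_two_le {m : ℕ} {κ : Type*} :
    IsWickRotationOf.schwinger_symmetric (d := m + 2) (κ := κ) :=
  IsWickRotationOf.schwinger_symmetric_of_euclid eq_zero_of_distributionalBoundaryValue_zero_holds
    (IsWightmanQFT.exists_invariant_continuation_of_spectral_of_laplace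
      (fun _ => IsWightmanQFT.hasSpectralCondition_family_holds)
      fun _ => Literature.Analysis.Distribution.fourierLaplace_coneSupport_holds)
    denseSpan_tensorProducts_holds IsWightmanQFT.euclid_continuation_perm_eq_holds

/-- **Symmetry and real analyticity of the Schwinger functions in space dimension `d = 0`
(quantum mechanics): the named fact `IsWickRotationOf.schwinger_symmetric` holds for `d = 0`.**
[cite: OsterwalderSchraderCMP1973, §5 p. 97] -/
theorem IsWickRotationOf.schwinger_symmetric_holds_zero {κ : Type*} :
    IsWickRotationOf.schwinger_symmetric (d := 0) (κ := κ) :=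
  IsWickRotationOf.schwinger_symmetric_of_euclid eq_zero_of_distributionalBoundaryValue_zero_holds
    (IsWightmanQFT.exists_invariant_continuation_of_spectral_of_laplace
      (fun _ => IsWightmanQFT.hasSpectralCondition_family_holds)
      fun _ => Literature.Analysis.Distribution.fourierLaplace_coneSupport_holds)
    denseSpan_tensorProducts_holds IsWightmanQFT.euclid_continuation_perm_eq_holds_zero

/-- **The named fact `IsWickRotationOf.schwinger_symmetric` holds in every space dimension
`d ≥ 2`** (wrapper of `schwinger_symmetric_holds_of_two_le` with the hypothesis `2 ≤ d`). [cite: OsterwalderSchraderCMP1973, §5 p. 97] -/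
theorem IsWickRotationOf.schwinger_symmetric_holds_of_le {d : ℕ} {κ : Type*} (hd : 2 ≤ d) :
    IsWickRotationOf.schwinger_symmetric (d := d) (κ := κ) := by
  obtain ⟨m, rfl⟩ := Nat.exists_eq_add_of_le' hd
  exact @IsWickRotationOf.schwinger_symmetric_holds_of_two_le m κ

/-- **The named fact `IsWickRotationOf.schwinger_symmetric` holds in every space dimension
`d ≠ 1`** (`d = 0`: `schwinger_symmetric_holds_zero`; `d ≥ 2`: `schwinger_symmetric_holds_of_le`).
The case `d = 1` (two space-time dimensions) is not covered by this file. [cite: OsterwalderSchraderCMP1973, §5 p. 97] -/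
theorem IsWickRotationOf.schwinger_symmetric_holds_of_ne_one {d : ℕ} {κ : Type*} (hd : d ≠ 1) :
    IsWickRotationOf.schwinger_symmetric (d := d) (κ := κ) := by
  rcases Nat.lt_or_ge d 2 with h | h
  · have h0 : d = 0 := by omega
    subst h0
    exact @IsWickRotationOf.schwinger_symmetric_holds_zero κ
  · exact @IsWickRotationOf.schwinger_symmetric_holds_of_le d κ h

end Literature.MathematicalPhysics.QuantumLattice
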